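import Mathlib
import Summits.NavierStokesRegularity.FluidComputer.AbcInertiaCIBasesPrep
import Summits.NavierStokesRegularity.FluidComputer.AbcInertiaCIEigenvalues
import Summits.NavierStokesRegularity.FluidComputer.AbcInertiaBases

/-!
# INERTIA-3L instantiation — CLASS I twin, Part 14: ARBITRARY real orthonormal orbit bases — the class-I
# certificate facts (R1)(R2) may be stated in the certifier's OWN basis (instab3 g9, cell `ns-blowup`, 2026-08-27)

HONEST FRAMING (human rulings D-0035/D-0074): nothing here is a claim about Navier–Stokes blow-up.
WHAT THIS IS NOT: not NS evidence. MODEL lane (forced-ABC linearisation, CLASS I); no certificate, number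
or census word moves.

Port of instab4 g7's `AbcClassIIBases` §1 (conjugation of the section matrices by the orthogonal coefficient
kernel: `coefQ_transpose_mul_self`, `coefQ_mul_transpose_self`, `coefQ_comm_diag`, `sum_sum_coefQ_amat`,
`section_conj_sq`, `section_conj_offdiag`) and of instab3 g8's `AbcInertiaBases` to cert-3 g9's `AbcClassI`
layer: **`card_classI_eigenfunctions_le_of_inertia_certificate_of_bases`** — for ANY family `e` of real
orthonormal bases of the class-I orbit spaces `AbcClassI.realSpace O` (basis families `bf`, first-order matrix
`am i j = Re Σ_k ⟪bf i k, Π_k X(bf j)(k)⟫`), (R1)(R2) for `Â' = [(−|O|²/R − a)δ + am]_{HH}`, `F₂' = GH'·am_{HB} +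
am_{BH}ᵀ`, a symmetric head weight `GH'` and `V'` IN THE BASES `e`, plus (R3), imply: at most `m` pairwise
distinct classical CLASS-I eigenvalues with `Re z ≥ a` (conclusion basis-free). Hence the AUDIT-BASIS clause of a
class-I INERTIA-3L cell reads exactly as for class II (`AbcInertiaBases`) and X0 (KERNEL-CHAIN §6): «per orbit of
`|O|² ≤ (r_H+1)²`, the certifier's vectors are transversal, class I, conjugate-symmetric, real-orthonormal and
`AbcClassI.odim O` in number». Every statement carries `AbcClassI.` prefixes (textual dedup lint); generic matrix
lemmas (`dotProduct_transpose_mulVec`, `dotProduct_conj_mulVec`, `conj_form_eq`) are REUSED from the class-II files.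
Mathlib + the three files named; no new definitions; std axioms. [folklore]
-/

noncomputable section

open scoped BigOperators ComplexConjugate InnerProductSpace Matrix
open Finset Matrix MeasureTheory UnitAddTorus

namespace Summit.NavierStokesRegularity.FluidComputer.AbcInertiaCI

open Literature.Analysis.FunctionSpaces Literature.Analysis.FunctionSpaces.Torus
open Literature.Analysis.FunctionSpaces.EuclideanSpace
open Literature.Analysis.FluidPDE Literature.Analysis.FluidPDE.SteadyLattice
open Summit.NavierStokesRegularity.FluidComputer.AbcClassI
open Summit.NavierStokesRegularity.FluidComputer.AbcClassII (Fam crossForm secOp rotR rotS sgnAct sgnOrbit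
  cube extend restrictTo extend_add extend_smul extend_zero rotR_add rotR_smul rotS_add rotS_smul
  crossForm_add crossForm_smul secOp_add secOp_smul restrictTo_add restrictTo_smul Orbit toOrbit onormSq
  osupNorm cubeOrbits nbrOrbits mem_sgnOrbit mem_sgnOrbit_self card_sgnOrbit_le sgnOrbit_eq_of_mem
  mem_sgnOrbit_comm sgnOrbit_eq_or_disjoint neg_mem_sgnOrbit neg_self_mem_sgnOrbit rotFreqR_mem_sgnOrbit
  rotFreqS_mem_sgnOrbit freqNormSq_eq_of_mem_sgnOrbit supNorm_eq_of_mem_sgnOrbit mem_cube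
  mem_cube_iff_supNorm cube_mono sgnOrbit_subset_cube zero_not_mem_sgnOrbit ne_zero_of_mem_sgnOrbit
  toOrbit_val toOrbit_eq_iff mem_cubeOrbits mem_nbrOrbits mem_nbrOrbits_comm card_nbrOrbits_le rotR_apply
  rotS_apply freqNormSq_rotFreq secOp_conj isConjSymm_secOp kdot_secOp mem_iff_of_orbitClosed
  isConjSymm_cut kdot_cut orbitClosed_cube_ne_zero orbitClosed_shell neg_mem_of_orbitClosed
  isConjSymm_lerayCrossForm kdot_conj conj_eq_zero_of_not_mem linOp_zero_eq conj_theta_neg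
  extend_apply_of_mem extend_apply_of_not_mem restrictTo_extend extend_restrictTo extend_sum
  inner_eq_sum_extend inner_conjVec_conjVec conj_sum_inner_of_isConjSymm sum_inner_eq_re_of_isConjSymm
  real_inner_eq_re real_smul_eq norm_lerayCrossForm_le sobolevWeight_one_eq cube_filter_eq_biUnion sum_cube_filter_eq
  onormSq_nonneg Orbit.disjoint_of_ne dotProduct_transpose_mulVec)

/-! ## Arbitrary real orthonormal orbit bases, class I (conjugation and the INERTIA-3L count) -/

section Bases

variable (e : ∀ O : Orbit, OrthonormalBasis (Fin (AbcClassI.odim O)) ℝ (AbcClassI.realSpace O.1))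
variable (bf : AbcClassI.Idx → Fam)
variable (hbf : ∀ i : AbcClassI.Idx, bf i = extend i.1.1 ((e i.1 i.2 : AbcClassI.realSpace i.1.1) : EuclideanSpace ℂ (↥i.1.1 × Fin 3)))
variable (am : AbcClassI.Idx → AbcClassI.Idx → ℝ)
variable (ham : ∀ i j : AbcClassI.Idx, am i j =
  (∑ k ∈ i.1.1, (inner ℂ (bf i k) (Torus.lerayCoeff k (crossForm 1 1 1 (bf j) k)) : ℂ)).re)

/-! ### §1 Conjugation of the section matrices by the orthogonal coefficient matrix -/

section
include hbf

/-- **`Q_Tᵀ Q_T = 1`** on an orbit-saturated index set `T`. -/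
theorem coefQ_transpose_mul_self {T : Finset AbcClassI.Idx} (hT : ∀ i ∈ T, ∀ a : Fin (AbcClassI.odim i.1), (⟨i.1, a⟩ : AbcClassI.Idx) ∈ T) :
    (Matrix.of fun i j : ↥T => (∑ k ∈ (i : AbcClassI.Idx).1.1, (inner ℂ (AbcClassI.bfam i k) (bf j k) : ℂ)).re)ᵀ *
      (Matrix.of fun i j : ↥T => (∑ k ∈ (i : AbcClassI.Idx).1.1, (inner ℂ (AbcClassI.bfam i k) (bf j k) : ℂ)).re) = 1 := by
  ext j j'
  rw [Matrix.mul_apply, Matrix.one_apply]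
  simp only [Matrix.transpose_apply, Matrix.of_apply]
  rw [Finset.sum_coe_sort T (fun i : AbcClassI.Idx => (∑ k ∈ i.1.1, (inner ℂ (AbcClassI.bfam i k) (bf j k) : ℂ)).re *
    (∑ k ∈ i.1.1, (inner ℂ (AbcClassI.bfam i k) (bf j' k) : ℂ)).re), sum_coefQ_cols e bf hbf hT j.2 j'.2]
  by_cases h : j = j'
  · subst h; simp
  · rw [if_neg h, if_neg fun h' => h (Subtype.ext h')]

/-- **`Q_T Q_Tᵀ = 1`** on an orbit-saturated index set `T`. -/
theorem coefQ_mul_transpose_self {T : Finset AbcClassI.Idx} (hT : ∀ i ∈ T, ∀ a : Fin (AbcClassI.odim i.1), (⟨i.1, a⟩ : AbcClassI.Idx) ∈ T) :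
    (Matrix.of fun i j : ↥T => (∑ k ∈ (i : AbcClassI.Idx).1.1, (inner ℂ (AbcClassI.bfam i k) (bf j k) : ℂ)).re) *
      (Matrix.of fun i j : ↥T => (∑ k ∈ (i : AbcClassI.Idx).1.1, (inner ℂ (AbcClassI.bfam i k) (bf j k) : ℂ)).re)ᵀ = 1 := by
  ext i i'
  rw [Matrix.mul_apply, Matrix.one_apply]
  simp only [Matrix.transpose_apply, Matrix.of_apply]
  rw [Finset.sum_coe_sort T (fun j : AbcClassI.Idx => (∑ k ∈ (i : AbcClassI.Idx).1.1, (inner ℂ (AbcClassI.bfam i k) (bf j k) : ℂ)).re *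
    (∑ k ∈ (i' : AbcClassI.Idx).1.1, (inner ℂ (AbcClassI.bfam i' k) (bf j k) : ℂ)).re), sum_coefQ_rows e bf hbf hT i.2 i'.2]
  by_cases h : i = i'
  · subst h; simp
  · rw [if_neg h, if_neg fun h' => h (Subtype.ext h')]

/-- The coefficient kernel commutes with any orbitwise-constant diagonal: `κ_i Q i j = Q i j κ_j`. -/
theorem coefQ_comm_diag (κ : AbcClassI.Idx → ℝ) (hκ : ∀ i j : AbcClassI.Idx, i.1 = j.1 → κ i = κ j) (i j : AbcClassI.Idx) :
    κ i * (∑ k ∈ i.1.1, (inner ℂ (AbcClassI.bfam i k) (bf j k) : ℂ)).re =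
      (∑ k ∈ i.1.1, (inner ℂ (AbcClassI.bfam i k) (bf j k) : ℂ)).re * κ j := by
  by_cases h : i.1 = j.1
  · rw [hκ i j h, mul_comm]
  · rw [coefQ_eq_zero_of_ne e bf hbf h, mul_zero, zero_mul]

include ham

/-- The first-order part: `Σ_{i' ∈ T₂} (Σ_{i ∈ T₁} Q i j · AbcClassI.amat i i') · Q i' j' = am j j'`. -/
theorem sum_sum_coefQ_amat {T₁ T₂ : Finset AbcClassI.Idx} (hT₁ : ∀ i ∈ T₁, ∀ a : Fin (AbcClassI.odim i.1), (⟨i.1, a⟩ : AbcClassI.Idx) ∈ T₁)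
    (hT₂ : ∀ i ∈ T₂, ∀ a : Fin (AbcClassI.odim i.1), (⟨i.1, a⟩ : AbcClassI.Idx) ∈ T₂) (j : ↥T₁) (j' : ↥T₂) :
    ∑ i' : ↥T₂, (∑ i : ↥T₁, (∑ k ∈ (i : AbcClassI.Idx).1.1, (inner ℂ (AbcClassI.bfam i k) (bf j k) : ℂ)).re * AbcClassI.amat i i') *
      (∑ k ∈ (i' : AbcClassI.Idx).1.1, (inner ℂ (AbcClassI.bfam i' k) (bf j' k) : ℂ)).re = am j j' := by
  rw [ham, eamat_eq_sum e bf hbf hT₁ hT₂ j.2 j'.2, Finset.sum_comm,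
    ← Finset.sum_coe_sort T₂]
  refine Finset.sum_congr rfl fun i' _ => ?_
  rw [← Finset.sum_coe_sort T₁, Finset.sum_mul]

/-- **Conjugation of the SQUARE section matrix on a saturated index set**: `S'_T(x) = Q_Tᵀ S_T(x) Q_T`. -/
theorem section_conj_sq {T : Finset AbcClassI.Idx} (hT : ∀ i ∈ T, ∀ a : Fin (AbcClassI.odim i.1), (⟨i.1, a⟩ : AbcClassI.Idx) ∈ T) (R x : ℝ) :
    (Matrix.of fun a b : ↥T => (if (a : AbcClassI.Idx) = b then x + onormSq (b : AbcClassI.Idx).1 / R else 0) - am a b) =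
      (Matrix.of fun i j : ↥T => (∑ k ∈ (i : AbcClassI.Idx).1.1, (inner ℂ (AbcClassI.bfam i k) (bf j k) : ℂ)).re)ᵀ *
        (Matrix.of fun a b : ↥T => (if (a : AbcClassI.Idx) = b then x + onormSq (b : AbcClassI.Idx).1 / R else 0) - AbcClassI.amat a b) *
        (Matrix.of fun i j : ↥T => (∑ k ∈ (i : AbcClassI.Idx).1.1, (inner ℂ (AbcClassI.bfam i k) (bf j k) : ℂ)).re) := by
  have hone := coefQ_transpose_mul_self e bf hbf hT
  ext j j'
  have hone' := congrFun (congrFun hone j) j'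
  rw [Matrix.mul_apply, Matrix.one_apply] at hone'
  simp only [Matrix.transpose_apply, Matrix.of_apply] at hone'
  rw [Matrix.mul_apply]
  simp only [Matrix.mul_apply, Matrix.transpose_apply, Matrix.of_apply, mul_sub, Finset.sum_sub_distrib,
    sub_mul]
  congr 1
  · -- the diagonal part
    have hdiag : ∀ i' : ↥T, (∑ i : ↥T, (∑ k ∈ (i : AbcClassI.Idx).1.1, (inner ℂ (AbcClassI.bfam i k) (bf j k) : ℂ)).re *
        (if (i : AbcClassI.Idx) = i' then x + onormSq (i' : AbcClassI.Idx).1 / R else 0)) =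
        (∑ k ∈ (i' : AbcClassI.Idx).1.1, (inner ℂ (AbcClassI.bfam i' k) (bf j k) : ℂ)).re * (x + onormSq (j : AbcClassI.Idx).1 / R) := by
      intro i'
      rw [Finset.sum_eq_single i' (fun i _ hi => by rw [if_neg fun h => hi (Subtype.ext h), mul_zero])
        (fun h => absurd (Finset.mem_univ _) h), if_pos rfl]
      have hc := coefQ_comm_diag e bf hbf (fun i => x + onormSq i.1 / R) (fun i j h => by simp only [h]) i' j
      linarith [hc]
    simp_rw [hdiag]
    rw [show ∑ i' : ↥T, (∑ k ∈ (i' : AbcClassI.Idx).1.1, (inner ℂ (AbcClassI.bfam i' k) (bf j k) : ℂ)).re * (x + onormSq (j : AbcClassI.Idx).1 / R) *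
        (∑ k ∈ (i' : AbcClassI.Idx).1.1, (inner ℂ (AbcClassI.bfam i' k) (bf j' k) : ℂ)).re =
        (x + onormSq (j : AbcClassI.Idx).1 / R) * ∑ i' : ↥T, (∑ k ∈ (i' : AbcClassI.Idx).1.1, (inner ℂ (AbcClassI.bfam i' k) (bf j k) : ℂ)).re *
          (∑ k ∈ (i' : AbcClassI.Idx).1.1, (inner ℂ (AbcClassI.bfam i' k) (bf j' k) : ℂ)).re by
      rw [Finset.mul_sum]; exact Finset.sum_congr rfl fun _ _ => by ring, hone']
    by_cases h : j = j'
    · subst h; simp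
    · rw [if_neg h, if_neg fun h' => h (Subtype.ext h'), mul_zero]
  · exact (sum_sum_coefQ_amat e bf hbf am ham hT hT j j').symm

/-- **Conjugation of an OFF-DIAGONAL block between disjoint saturated index sets**:
`S'_{T₁T₂}(x) = Q_{T₁}ᵀ S_{T₁T₂}(x) Q_{T₂}` (the diagonal `if`s never fire). -/
theorem section_conj_offdiag {T₁ T₂ : Finset AbcClassI.Idx} (hT₁ : ∀ i ∈ T₁, ∀ a : Fin (AbcClassI.odim i.1), (⟨i.1, a⟩ : AbcClassI.Idx) ∈ T₁)
    (hT₂ : ∀ i ∈ T₂, ∀ a : Fin (AbcClassI.odim i.1), (⟨i.1, a⟩ : AbcClassI.Idx) ∈ T₂) (hdis : Disjoint T₁ T₂) (R x : ℝ) :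
    (Matrix.of fun (a : ↥T₁) (b : ↥T₂) => (if (a : AbcClassI.Idx) = b then x + onormSq (b : AbcClassI.Idx).1 / R else 0) - am a b) =
      (Matrix.of fun i j : ↥T₁ => (∑ k ∈ (i : AbcClassI.Idx).1.1, (inner ℂ (AbcClassI.bfam i k) (bf j k) : ℂ)).re)ᵀ *
        (Matrix.of fun (a : ↥T₁) (b : ↥T₂) => (if (a : AbcClassI.Idx) = b then x + onormSq (b : AbcClassI.Idx).1 / R else 0) - AbcClassI.amat a b) *
        (Matrix.of fun i j : ↥T₂ => (∑ k ∈ (i : AbcClassI.Idx).1.1, (inner ℂ (AbcClassI.bfam i k) (bf j k) : ℂ)).re) := by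
  have hne : ∀ (a : ↥T₁) (b : ↥T₂), (a : AbcClassI.Idx) ≠ b := fun a b h =>
    Finset.disjoint_left.mp hdis a.2 (h ▸ b.2)
  ext j j'
  rw [Matrix.mul_apply]
  simp only [Matrix.mul_apply, Matrix.transpose_apply, Matrix.of_apply, if_neg (hne _ _), zero_sub, mul_neg,
    Finset.sum_neg_distrib, neg_mul]
  rw [sum_sum_coefQ_amat e bf hbf am ham hT₁ hT₂ j j']

end


/-! ### §2 The INERTIA-3L count in arbitrary real orthonormal orbit bases (class I) -/

/-- An index set characterised by the orbit norm is orbit-saturated. -/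
theorem saturated_of_mem_iff {T : Finset AbcClassI.Idx} {P : ℝ → Prop} (hT : ∀ i : AbcClassI.Idx, i ∈ T ↔ P (onormSq i.1)) :
    ∀ i ∈ T, ∀ a : Fin (AbcClassI.odim i.1), (⟨i.1, a⟩ : AbcClassI.Idx) ∈ T := by
  intro i hi a
  exact (hT ⟨i.1, a⟩).mpr ((hT i).mp hi)

include hbf ham in
/-- **INERTIA-3L, END TO END, IN ARBITRARY ORBIT BASES (CLASS I, classical form).** For any family `e` of
real orthonormal bases of the class-I orbit spaces: (R1)(R2) for the matrices in the bases `e` (first-order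
matrix `am`, head weight `GH'`, `V'`) and (R3) ⇒ at most `m` pairwise distinct classical class-I eigenvalues
`z` of the linearisation about `abcFlow 1 1 1` at viscosity `1/(2πR)` with `Re z ≥ a`. -/
theorem card_classI_eigenfunctions_le_of_inertia_certificate_of_bases {R a rL rH : ℝ} {HL HH HB : Finset AbcClassI.Idx}
    {m : ℕ} (hR : 0 < R) (h0 : 0 ≤ rL) (hLH : rL + 1 ≤ rH)
    (hHL : ∀ i : AbcClassI.Idx, i ∈ HL ↔ onormSq i.1 ≤ rL ^ 2)
    (hHH : ∀ i : AbcClassI.Idx, i ∈ HH ↔ onormSq i.1 ≤ rH ^ 2)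
    (hHB : ∀ i : AbcClassI.Idx, i ∈ HB ↔ rH ^ 2 < onormSq i.1 ∧ onormSq i.1 ≤ (rH + 1) ^ 2)
    (GH' Ah' : Matrix ↥HH ↥HH ℝ) (AHB' : Matrix ↥HH ↥HB ℝ) (ABH' : Matrix ↥HB ↥HH ℝ) (E : ↥HB → ℝ)
    (V' : Matrix ↥HH (Fin m) ℝ) (hGH' : GH'ᵀ = GH')
    (hAh' : Ah' = Matrix.of fun i j : ↥HH => (if i = j then -(onormSq i.1.1 / R) - a else 0) + am i.1 j.1)
    (hAHB' : AHB' = Matrix.of fun (i : ↥HH) (l : ↥HB) => am i.1 l.1)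
    (hABH' : ABH' = Matrix.of fun (l : ↥HB) (i : ↥HH) => am l.1 i.1)
    (hE : E = fun l : ↥HB => onormSq l.1.1 / R + a - Real.sqrt 2)
    (hR1' : ∀ x : ↥HH → ℝ, x ≠ 0 →
      x ⬝ᵥ ((GH' * Ah' + Ah'ᵀ * GH' + (1 / 2 : ℝ) • ((GH' * AHB' + ABH'ᵀ) * Matrix.diagonal (fun l => (E l)⁻¹) *
        (GH' * AHB' + ABH'ᵀ)ᵀ)) *ᵥ x) < 0)
    (hR2' : ∀ x : ↥HH → ℝ, 0 ≤ x ⬝ᵥ ((GH' + V' * V'ᵀ) *ᵥ x))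
    (hR3 : Real.sqrt 2 < ((⌊rH ^ 2⌋₊ : ℝ) + 1) / R + a)
    {n : ℕ} (z : Fin n → ℂ) (hz : Function.Injective z)
    (u : Fin n → UnitAddTorus (Fin 3) → EuclideanSpace ℂ (Fin 3))
    (hu : ∀ k, Torus.LinNSResolventRel (1 / (2 * Real.pi * R)) (Torus.abcFlow 1 1 1) (2 * Real.pi * z k) (u k) 0)
    (hu0 : ∀ k, u k ≠ 0) (hII : ∀ k, IsClassI (mFourierCoeff (u k))) (hre : ∀ k, a ≤ (z k).re) :
    n ≤ m := by
  classical
  -- saturation and disjointness of the index sets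
  have hsH : ∀ i ∈ HH, ∀ c : Fin (AbcClassI.odim i.1), (⟨i.1, c⟩ : AbcClassI.Idx) ∈ HH :=
    saturated_of_mem_iff (P := fun q => q ≤ rH ^ 2) hHH
  have hsB : ∀ i ∈ HB, ∀ c : Fin (AbcClassI.odim i.1), (⟨i.1, c⟩ : AbcClassI.Idx) ∈ HB :=
    saturated_of_mem_iff (P := fun q => rH ^ 2 < q ∧ q ≤ (rH + 1) ^ 2) hHB
  have hdis : Disjoint HH HB := disjoint_HH_HB hHH hHB
  -- the change-of-basis matrices
  set QH : Matrix ↥HH ↥HH ℝ :=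
    Matrix.of fun i j : ↥HH => (∑ k ∈ (i : AbcClassI.Idx).1.1, (inner ℂ (AbcClassI.bfam i k) (bf j k) : ℂ)).re with hQH
  set QB : Matrix ↥HB ↥HB ℝ :=
    Matrix.of fun i j : ↥HB => (∑ k ∈ (i : AbcClassI.Idx).1.1, (inner ℂ (AbcClassI.bfam i k) (bf j k) : ℂ)).re with hQB
  have hQH1 : QHᵀ * QH = 1 := coefQ_transpose_mul_self e bf hbf hsH
  have hQH2 : QH * QHᵀ = 1 := coefQ_mul_transpose_self e bf hbf hsH
  have hQB1 : QBᵀ * QB = 1 := coefQ_transpose_mul_self e bf hbf hsB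
  have hQB2 : QB * QBᵀ = 1 := coefQ_mul_transpose_self e bf hbf hsB
  -- the matrices in the basis `AbcClassI.bfam`
  set Ah : Matrix ↥HH ↥HH ℝ :=
    Matrix.of fun i j : ↥HH => (if i = j then -(onormSq i.1.1 / R) - a else 0) + AbcClassI.amat i.1 j.1 with hAh
  set AHB : Matrix ↥HH ↥HB ℝ := Matrix.of fun (i : ↥HH) (l : ↥HB) => AbcClassI.amat i.1 l.1 with hAHB
  set ABH : Matrix ↥HB ↥HH ℝ := Matrix.of fun (l : ↥HB) (i : ↥HH) => AbcClassI.amat l.1 i.1 with hABH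
  set GH : Matrix ↥HH ↥HH ℝ := QH * GH' * QHᵀ with hGH
  set V : Matrix ↥HH (Fin m) ℝ := QH * V' with hV
  -- (ii) `Ah' = QHᵀ Ah QH` (from `section_conj_sq` at `x = a`: `Ah = −S(a)`)
  have hSa : Ah = -(Matrix.of fun i j : ↥HH =>
      (if (i : AbcClassI.Idx) = j then a + onormSq (j : AbcClassI.Idx).1 / R else 0) - AbcClassI.amat i j) := by
    ext i j
    simp only [hAh, Matrix.of_apply, Matrix.neg_apply]
    by_cases h : i = j
    · subst h; simp; ring
    · rw [if_neg h, if_neg fun h' => h (Subtype.ext h')]; ring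
  have hSa' : Ah' = -(Matrix.of fun i j : ↥HH =>
      (if (i : AbcClassI.Idx) = j then a + onormSq (j : AbcClassI.Idx).1 / R else 0) - am i j) := by
    ext i j
    simp only [hAh', Matrix.of_apply, Matrix.neg_apply]
    by_cases h : i = j
    · subst h; simp; ring
    · rw [if_neg h, if_neg fun h' => h (Subtype.ext h')]; ring
  have hcA : Ah' = QHᵀ * Ah * QH := by
    rw [hSa', hSa, section_conj_sq e bf hbf am ham hsH R a, Matrix.mul_neg, Matrix.neg_mul]
  -- (iii) the off-diagonal blocks
  have hcHB : AHB' = QHᵀ * AHB * QB := by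
    have h := section_conj_offdiag e bf hbf am ham hsH hsB hdis R a
    have hne : ∀ (i : ↥HH) (l : ↥HB), (i : AbcClassI.Idx) ≠ l := fun i l h' =>
      Finset.disjoint_left.mp hdis i.2 (h' ▸ l.2)
    have e1 : (Matrix.of fun (i : ↥HH) (l : ↥HB) =>
        (if (i : AbcClassI.Idx) = l then a + onormSq (l : AbcClassI.Idx).1 / R else 0) - am i l) = -AHB' := by
      ext i l; simp [hAHB', if_neg (hne i l)]
    have e2 : (Matrix.of fun (i : ↥HH) (l : ↥HB) =>
        (if (i : AbcClassI.Idx) = l then a + onormSq (l : AbcClassI.Idx).1 / R else 0) - AbcClassI.amat i l) = -AHB := by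
      ext i l; simp [hAHB, if_neg (hne i l)]
    rw [e1, e2, Matrix.mul_neg, Matrix.neg_mul] at h
    exact neg_injective h
  have hcBH : ABH' = QBᵀ * ABH * QH := by
    have h := section_conj_offdiag e bf hbf am ham hsB hsH hdis.symm R a
    have hne : ∀ (l : ↥HB) (i : ↥HH), (l : AbcClassI.Idx) ≠ i := fun l i h' =>
      Finset.disjoint_left.mp hdis i.2 (h' ▸ l.2)
    have e1 : (Matrix.of fun (l : ↥HB) (i : ↥HH) =>
        (if (l : AbcClassI.Idx) = i then a + onormSq (i : AbcClassI.Idx).1 / R else 0) - am l i) = -ABH' := by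
      ext l i; simp [hABH', if_neg (hne l i)]
    have e2 : (Matrix.of fun (l : ↥HB) (i : ↥HH) =>
        (if (l : AbcClassI.Idx) = i then a + onormSq (i : AbcClassI.Idx).1 / R else 0) - AbcClassI.amat l i) = -ABH := by
      ext l i; simp [hABH, if_neg (hne l i)]
    rw [e1, e2, Matrix.mul_neg, Matrix.neg_mul] at h
    exact neg_injective h
  -- (iv) the tail constants commute with `QB`
  have hDQ : Matrix.diagonal (fun l : ↥HB => (E l)⁻¹) * QB = QB * Matrix.diagonal (fun l : ↥HB => (E l)⁻¹) := by
    ext l l'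
    rw [Matrix.diagonal_mul, Matrix.mul_diagonal]
    simp only [hQB, Matrix.of_apply, hE]
    exact coefQ_comm_diag e bf hbf (fun i : AbcClassI.Idx => (onormSq i.1 / R + a - Real.sqrt 2)⁻¹)
      (fun i j h => by simp only [h]) l l'
  -- (v) `GH' = QHᵀ GH QH`, and the conjugation of `𝓜`
  have hGHc : QHᵀ * GH * QH = GH' := by
    rw [hGH]
    calc QHᵀ * (QH * GH' * QHᵀ) * QH = (QHᵀ * QH) * GH' * (QHᵀ * QH) := by
          simp only [Matrix.mul_assoc]
      _ = GH' := by rw [hQH1, Matrix.one_mul, Matrix.mul_one]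
  have hGHsymm : GHᵀ = GH := by
    rw [hGH, Matrix.transpose_mul, Matrix.transpose_mul, Matrix.transpose_transpose, hGH', Matrix.mul_assoc]
  have hM0 : GH' * Ah' + Ah'ᵀ * GH' = QHᵀ * (GH * Ah + Ahᵀ * GH) * QH := by
    rw [← hGHc, hcA]
    have e1 : QHᵀ * GH * QH * (QHᵀ * Ah * QH) = QHᵀ * (GH * Ah) * QH := by
      calc QHᵀ * GH * QH * (QHᵀ * Ah * QH) = QHᵀ * GH * (QH * QHᵀ) * Ah * QH := by
            simp only [Matrix.mul_assoc]
        _ = QHᵀ * (GH * Ah) * QH := by rw [hQH2, Matrix.mul_one]; simp only [Matrix.mul_assoc]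
    have e2 : (QHᵀ * Ah * QH)ᵀ * (QHᵀ * GH * QH) = QHᵀ * (Ahᵀ * GH) * QH := by
      rw [Matrix.transpose_mul, Matrix.transpose_mul, Matrix.transpose_transpose]
      calc QHᵀ * (Ahᵀ * QHᵀᵀ) * (QHᵀ * GH * QH) = QHᵀ * Ahᵀ * (QH * QHᵀ) * GH * QH := by
            rw [Matrix.transpose_transpose]; simp only [Matrix.mul_assoc]
        _ = QHᵀ * (Ahᵀ * GH) * QH := by rw [hQH2, Matrix.mul_one]; simp only [Matrix.mul_assoc]
    rw [e1, e2, Matrix.mul_add, Matrix.add_mul]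
  have hF2 : GH' * AHB' + ABH'ᵀ = QHᵀ * (GH * AHB + ABHᵀ) * QB := by
    rw [← hGHc, hcHB, hcBH]
    have e1 : QHᵀ * GH * QH * (QHᵀ * AHB * QB) = QHᵀ * (GH * AHB) * QB := by
      calc QHᵀ * GH * QH * (QHᵀ * AHB * QB) = QHᵀ * GH * (QH * QHᵀ) * AHB * QB := by
            simp only [Matrix.mul_assoc]
        _ = QHᵀ * (GH * AHB) * QB := by rw [hQH2, Matrix.mul_one]; simp only [Matrix.mul_assoc]
    have e2 : (QBᵀ * ABH * QH)ᵀ = QHᵀ * ABHᵀ * QB := by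
      rw [Matrix.transpose_mul, Matrix.transpose_mul, Matrix.transpose_transpose, Matrix.mul_assoc]
    rw [e1, e2, Matrix.mul_add, Matrix.add_mul]
  have hM : GH' * Ah' + Ah'ᵀ * GH' + (1 / 2 : ℝ) • ((GH' * AHB' + ABH'ᵀ) * Matrix.diagonal (fun l => (E l)⁻¹) *
      (GH' * AHB' + ABH'ᵀ)ᵀ) =
      QHᵀ * (GH * Ah + Ahᵀ * GH + (1 / 2 : ℝ) • ((GH * AHB + ABHᵀ) * Matrix.diagonal (fun l => (E l)⁻¹) *
        (GH * AHB + ABHᵀ)ᵀ)) * QH := by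
    rw [hM0, hF2]
    have e3 : QHᵀ * (GH * AHB + ABHᵀ) * QB * Matrix.diagonal (fun l => (E l)⁻¹) * (QHᵀ * (GH * AHB + ABHᵀ) * QB)ᵀ =
        QHᵀ * ((GH * AHB + ABHᵀ) * Matrix.diagonal (fun l => (E l)⁻¹) * (GH * AHB + ABHᵀ)ᵀ) * QH := by
      rw [Matrix.transpose_mul, Matrix.transpose_mul, Matrix.transpose_transpose]
      calc QHᵀ * (GH * AHB + ABHᵀ) * QB * Matrix.diagonal (fun l => (E l)⁻¹) * (QBᵀ * ((GH * AHB + ABHᵀ)ᵀ * QHᵀᵀ))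
          = QHᵀ * (GH * AHB + ABHᵀ) * (QB * Matrix.diagonal (fun l => (E l)⁻¹) * QBᵀ) *
              ((GH * AHB + ABHᵀ)ᵀ * QH) := by
            rw [Matrix.transpose_transpose]; simp only [Matrix.mul_assoc]
        _ = QHᵀ * ((GH * AHB + ABHᵀ) * Matrix.diagonal (fun l => (E l)⁻¹) * (GH * AHB + ABHᵀ)ᵀ) * QH := by
            rw [← hDQ, Matrix.mul_assoc (Matrix.diagonal _) QB QBᵀ, hQB2, Matrix.mul_one]
            simp only [Matrix.mul_assoc]
    rw [e3]
    simp only [Matrix.mul_add, Matrix.add_mul, Matrix.mul_smul, Matrix.smul_mul, Matrix.mul_assoc]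
  -- (vi) (R1) transfers
  have hR1 : ∀ x : ↥HH → ℝ, x ≠ 0 →
      x ⬝ᵥ ((GH * Ah + Ahᵀ * GH + (1 / 2 : ℝ) • ((GH * AHB + ABHᵀ) * Matrix.diagonal (fun l => (E l)⁻¹) *
        (GH * AHB + ABHᵀ)ᵀ)) *ᵥ x) < 0 := by
    intro x hx
    have hx' : QHᵀ *ᵥ x ≠ 0 := by
      intro h
      apply hx
      have := congrArg (fun v => QH *ᵥ v) h
      rwa [Matrix.mulVec_mulVec, hQH2, Matrix.one_mulVec, Matrix.mulVec_zero] at this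
    have key := hR1' (QHᵀ *ᵥ x) hx'
    rw [hM, AbcInertia.conj_form_eq QH _ hQH2] at key
    exact key
  -- (vii) (R2) transfers
  have hR2 : ∀ x : ↥HH → ℝ, 0 ≤ x ⬝ᵥ ((GH + V * Vᵀ) *ᵥ x) := by
    intro x
    have e1 : GH + V * Vᵀ = QH * (GH' + V' * V'ᵀ) * QHᵀ := by
      rw [hGH, hV, Matrix.transpose_mul, Matrix.mul_add, Matrix.add_mul]
      simp only [Matrix.mul_assoc]
    rw [e1, AbcInertia.dotProduct_conj_mulVec]
    exact hR2' _
  exact card_classI_eigenfunctions_le_of_inertia_certificate hR h0 hLH hHL hHH hHB GH Ah AHB ABH E V hGHsymm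
    hAh hAHB hABH hE hR1 hR2 hR3 z hz u hu hu0 hII hre

end Bases

end Summit.NavierStokesRegularity.FluidComputer.AbcInertiaCI

end
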